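import Summits.Ventures.PercRepro.MSSplitProj

/-!
# Split families of excess one: a coordinate without twin pairs forces the co-singleton

Continuing `MSSplitProj.lean` (proofs/P4-gen9.md §7, Lemma A). Let `F` be a split family of finite
sets whose difference family `F \\ F` is a down-set, with excess one (`|F \\ F| = |F| + 1`), no
member a difference, and every element of a member a singleton difference. If a coordinate `r` has
NO twin pair (`partner r F = ∅`), then some member `B ∌ r` contains every other member up to `r`:
`∀ A ∈ F, A ⊆ insert r B` — `B` is the co-singleton `(⋃ F) \ {r}`.

Proof. By `tight_proj_of_split_excess_one`, `|Y| = |K| + 1 = 1`, and `∅ ∈ Y`, so `Y = {∅}`: every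
`ℓ ∈ L` (a member containing `r`, with `r` removed) lies inside every `B ∈ F₀` (a member avoiding
`r`). Then `(B, ℓ) ↦ B \ ℓ` is injective on `F₀ × L` and never `∅` (else `B = ℓ` would be a twin
pair), while `∅` is a difference of the projection; so `ab + 1 ≤ |proj \\ proj| = |proj| = a + b`
(`a = |F₀|`, `b = |L|`), i.e. `a = 1` or `b = 1`. If `a = 1`, `F₀ = {B}` and every member is below
`insert r B`. If `b = 1`, `L = {ℓ}`: the differences of the projection are exactly `{B \ ℓ} ∪ {∅}`,
so no singleton `{v}` with `v ∈ ℓ` is a difference — forcing `ℓ = ∅` and `{r} ∈ F`, a member that is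
a difference. ∎
-/

namespace PercRepro.MSTight

open Finset
open scoped FinsetFamily

variable {α : Type*} [DecidableEq α]

/-- `∅` is an `r`-difference (with `r` removed) as soon as `{r}` is a difference. -/
theorem empty_mem_diffsY_of_singleton_mem {r : α} {F : Finset (Finset α)}
    (hr : ({r} : Finset α) ∈ F \\ F) : (∅ : Finset α) ∈ diffsY r F := by
  obtain ⟨A, hA, B, hB, hAB⟩ := Finset.mem_diffs.1 hr
  have hrAB : r ∈ A \ B := by rw [hAB]; exact Finset.mem_singleton_self r
  have hrA : r ∈ A := (Finset.mem_sdiff.1 hrAB).1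
  have hrB : r ∉ B := (Finset.mem_sdiff.1 hrAB).2
  refine Finset.mem_diffs.2 ⟨A.erase r, mem_partr.2 ⟨Finset.notMem_erase r A, by
    rw [Finset.insert_erase hrA]; exact hA⟩, B, mem_part0.2 ⟨hB, hrB⟩, ?_⟩
  have hcomm : A.erase r \ B = (A \ B).erase r := by
    ext x
    simp only [Finset.mem_sdiff, Finset.mem_erase]
    tauto
  rw [hcomm, hAB, Finset.erase_singleton]

/-- **Lemma A.** In a split family of excess one with a down-closed difference family, no member a
difference and every element of a member a singleton difference, a coordinate `r` without twin
pairs yields a member `B ∌ r` with every member of `F` inside `insert r B`. -/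
theorem exists_cosingleton_of_partner_eq_empty {F : Finset (Finset α)} (u : Finset α)
    (hFu : ∀ A ∈ F, A ⊆ u) (hsplit : ¬ NoSplit F) (hD : IsDownSet (F \\ F))
    (hexc : (F \\ F).card = F.card + 1) (hFG : ∀ A ∈ F, A ∉ F \\ F)
    (hsing : ∀ A ∈ F, ∀ v ∈ A, ({v} : Finset α) ∈ F \\ F)
    {r : α} (hr : ({r} : Finset α) ∈ F \\ F) (hK : partner r F = ∅) :
    ∃ B ∈ F, r ∉ B ∧ ∀ A ∈ F, A ⊆ insert r B := by
  obtain ⟨hproj, hY⟩ := tight_proj_of_split_excess_one u hFu hsplit hD hexc hr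
  rw [hK, Finset.card_empty] at hY
  have h0 : (∅ : Finset α) ∈ diffsY r F := empty_mem_diffsY_of_singleton_mem hr
  -- `Y = {∅}`
  have hY1 : diffsY r F = {∅} := by
    symm
    apply Finset.eq_of_subset_of_card_le
    · exact Finset.singleton_subset_iff.2 h0
    · rw [hY, Finset.card_singleton]
  -- every `ℓ ∈ L` lies inside every `B ∈ F₀`
  have hsub : ∀ ℓ ∈ partr r F, ∀ B ∈ part0 r F, ℓ ⊆ B := by
    intro ℓ hℓ B hB
    have : ℓ \ B ∈ diffsY r F := Finset.mem_diffs.2 ⟨ℓ, hℓ, B, hB, rfl⟩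
    rw [hY1, Finset.mem_singleton] at this
    exact Finset.sdiff_eq_empty_iff_subset.1 this
  -- no `B \ ℓ` is empty (a twin pair would exist)
  have hne : ∀ B ∈ part0 r F, ∀ ℓ ∈ partr r F, B \ ℓ ≠ ∅ := by
    intro B hB ℓ hℓ h
    have h1 : B ⊆ ℓ := Finset.sdiff_eq_empty_iff_subset.1 h
    have h2 : B = ℓ := Finset.Subset.antisymm h1 (hsub ℓ hℓ B hB)
    have : B ∈ partner r F := Finset.mem_inter.2 ⟨hB, h2 ▸ hℓ⟩
    rw [hK] at this
    exact Finset.notMem_empty _ this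
  -- `(B, ℓ) ↦ B \ ℓ` is injective on `F₀ × L`
  have hinj : Set.InjOn (fun p : Finset α × Finset α => p.1 \ p.2)
      ((part0 r F ×ˢ partr r F : Finset _) : Set (Finset α × Finset α)) := by
    rintro ⟨B, ℓ⟩ hp ⟨B', ℓ'⟩ hp' h
    simp only [Finset.coe_product, Set.mem_prod, Finset.mem_coe] at hp hp'
    simp only at h
    have hℓB' : ℓ ⊆ B' := hsub ℓ hp.2 B' hp'.1
    have hℓ'B : ℓ' ⊆ B := hsub ℓ' hp'.2 B hp.1
    have hBB' : B = B' := by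
      apply Finset.Subset.antisymm
      · intro x hx
        by_cases hxℓ : x ∈ ℓ
        · exact hℓB' hxℓ
        · have : x ∈ B \ ℓ := Finset.mem_sdiff.2 ⟨hx, hxℓ⟩
          rw [h] at this
          exact (Finset.mem_sdiff.1 this).1
      · intro x hx
        by_cases hxℓ : x ∈ ℓ'
        · exact hℓ'B hxℓ
        · have : x ∈ B' \ ℓ' := Finset.mem_sdiff.2 ⟨hx, hxℓ⟩
          rw [← h] at this
          exact (Finset.mem_sdiff.1 this).1
    subst hBB'
    have hℓℓ' : ℓ = ℓ' := by
      apply Finset.Subset.antisymm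
      · intro x hx
        by_contra hx'
        have : x ∈ B \ ℓ' := Finset.mem_sdiff.2 ⟨hsub ℓ hp.2 B hp.1 hx, hx'⟩
        rw [← h] at this
        exact (Finset.mem_sdiff.1 this).2 hx
      · intro x hx
        by_contra hx'
        have : x ∈ B \ ℓ := Finset.mem_sdiff.2 ⟨hℓ'B hx, hx'⟩
        rw [h] at this
        exact (Finset.mem_sdiff.1 this).2 hx
    rw [hℓℓ']
  -- counting: `a b ≤ |F₀ \\ L|`, `∅ ∉ F₀ \\ L`, `∅ ∈ proj \\ proj`, `F₀ \\ L ⊆ proj \\ proj`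
  have hcard_le : (part0 r F).card * (partr r F).card ≤ (part0 r F \\ partr r F).card := by
    rw [← Finset.card_product]
    refine Finset.card_le_card_of_injOn (fun p : Finset α × Finset α => p.1 \ p.2) ?_ hinj
    intro p hp
    rw [Finset.mem_coe, Finset.mem_product] at hp
    exact Finset.mem_coe.2 (Finset.mem_diffs.2 ⟨p.1, hp.1, p.2, hp.2, rfl⟩)
  have hempty_notMem : (∅ : Finset α) ∉ part0 r F \\ partr r F := by
    intro h
    obtain ⟨B, hB, ℓ, hℓ, hBℓ⟩ := Finset.mem_diffs.1 h
    exact hne B hB ℓ hℓ hBℓ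
  have hYX : diffsY r F ⊆ diffsX r F := diffsY_subset_diffsX hD
  have hprojdiffs : proj r F \\ proj r F = diffsX r F := by
    rw [diffs_proj_eq, Finset.union_eq_left.2 hYX]
  have hXsub : insert (∅ : Finset α) (part0 r F \\ partr r F) ⊆ proj r F \\ proj r F := by
    rw [hprojdiffs]
    intro E hE
    rcases Finset.mem_insert.1 hE with rfl | hE
    · exact hYX h0
    · exact Finset.mem_union.2 (Or.inr hE)
  have hcardX : (proj r F \\ proj r F).card = (part0 r F).card + (partr r F).card := by
    have h1 := card_proj_add_card_partner r F
    rw [hK, Finset.card_empty, add_zero] at h1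
    unfold Tight at hproj
    omega
  have hcount : (part0 r F \\ partr r F).card + 1 ≤ (part0 r F).card + (partr r F).card := by
    have := Finset.card_le_card hXsub
    rw [Finset.card_insert_of_notMem hempty_notMem, hcardX] at this
    exact this
  -- `F₀` and `L` are nonempty (`{r}` is a difference)
  have hF0 : (part0 r F).Nonempty := by
    obtain ⟨A, hA, B, hB, hAB⟩ := Finset.mem_diffs.1 hr
    have hrAB : r ∈ A \ B := by rw [hAB]; exact Finset.mem_singleton_self r
    exact ⟨B, mem_part0.2 ⟨hB, (Finset.mem_sdiff.1 hrAB).2⟩⟩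
  have hL : (partr r F).Nonempty := by
    obtain ⟨A, hA, B, hB, hAB⟩ := Finset.mem_diffs.1 hr
    have hrAB : r ∈ A \ B := by rw [hAB]; exact Finset.mem_singleton_self r
    exact ⟨A.erase r, mem_partr.2 ⟨Finset.notMem_erase r A, by
      rw [Finset.insert_erase (Finset.mem_sdiff.1 hrAB).1]; exact hA⟩⟩
  have ha : 1 ≤ (part0 r F).card := Finset.card_pos.2 hF0
  have hb : 1 ≤ (partr r F).card := Finset.card_pos.2 hL
  -- `a b + 1 ≤ a + b` with `a, b ≥ 1` forces `a = 1` or `b = 1`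
  have hab : (part0 r F).card = 1 ∨ (partr r F).card = 1 := by
    by_contra hcon
    push Not at hcon
    have ha2 : 2 ≤ (part0 r F).card := by omega
    have hb2 : 2 ≤ (partr r F).card := by omega
    nlinarith
  rcases hab with ha1 | hb1
  · -- `F₀ = {B}`: the co-singleton
    obtain ⟨B, hB⟩ := Finset.card_eq_one.1 ha1
    have hBmem : B ∈ part0 r F := by rw [hB]; exact Finset.mem_singleton_self B
    obtain ⟨hBF, hrB⟩ := mem_part0.1 hBmem
    refine ⟨B, hBF, hrB, ?_⟩
    intro A hA
    by_cases hrA : r ∈ A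
    · have hℓ : A.erase r ∈ partr r F := mem_partr.2 ⟨Finset.notMem_erase r A, by
        rw [Finset.insert_erase hrA]; exact hA⟩
      have := hsub _ hℓ B hBmem
      intro x hx
      by_cases hxr : x = r
      · rw [hxr]; exact Finset.mem_insert_self r B
      · exact Finset.mem_insert_of_mem (this (Finset.mem_erase.2 ⟨hxr, hx⟩))
    · have : A ∈ part0 r F := mem_part0.2 ⟨hA, hrA⟩
      rw [hB, Finset.mem_singleton] at this
      rw [this]
      exact Finset.subset_insert r B
  · -- `L = {ℓ}`: impossible
    exfalso
    obtain ⟨ℓ, hℓ⟩ := Finset.card_eq_one.1 hb1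
    have hℓmem : ℓ ∈ partr r F := by rw [hℓ]; exact Finset.mem_singleton_self ℓ
    obtain ⟨hrℓ, hℓF⟩ := mem_partr.1 hℓmem
    -- the differences of the projection are exactly `{B \ ℓ} ∪ {∅}`
    have hXeq : insert (∅ : Finset α) (part0 r F \\ partr r F) = proj r F \\ proj r F := by
      apply Finset.eq_of_subset_of_card_le hXsub
      rw [Finset.card_insert_of_notMem hempty_notMem, hcardX, hb1]
      have : (part0 r F).card ≤ (part0 r F \\ partr r F).card := by
        have := hcard_le; rw [hb1, mul_one] at this; exact this
      omega
    -- a singleton `{v}` with `v ∈ ℓ` would be such a difference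
    have hℓempty : ℓ = ∅ := by
      by_contra hne'
      obtain ⟨v, hv⟩ := Finset.nonempty_iff_ne_empty.2 hne'
      have hvF : ({v} : Finset α) ∈ F \\ F :=
        hsing (insert r ℓ) hℓF v (Finset.mem_insert_of_mem hv)
      have hvr : r ∉ ({v} : Finset α) := by
        rw [Finset.mem_singleton]; rintro rfl; exact hrℓ hv
      have hvX : ({v} : Finset α) ∈ diffsX r F := by
        rw [← diffs_filter_notMem, Finset.mem_filter]; exact ⟨hvF, hvr⟩
      rw [← hprojdiffs, ← hXeq] at hvX
      rcases Finset.mem_insert.1 hvX with h | h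
      · exact Finset.singleton_ne_empty v h
      · obtain ⟨B, -, ℓ', hℓ', hBℓ⟩ := Finset.mem_diffs.1 h
        rw [hℓ, Finset.mem_singleton] at hℓ'
        subst hℓ'
        have : v ∈ B \ ℓ' := by rw [hBℓ]; exact Finset.mem_singleton_self v
        exact (Finset.mem_sdiff.1 this).2 hv
    -- then `{r} ∈ F` is a member that is a difference
    rw [hℓempty] at hℓF
    simp only [Finset.insert_empty] at hℓF
    exact hFG _ hℓF hr

end PercRepro.MSTight
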